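import Summits.ResolutionOfSingularities.ResolutionOfSingularities.Theorems.PurelyInseparableDim4ResConeTiltedTail
import Summits.ResolutionOfSingularities.ResolutionOfSingularities.Theorems.PurelyInseparableDim4ResConeBoundaryLetterFourFive
import HarnessLib
import HarnessLib.Audit.Tags

/-!
# Purely inseparable four-folds — TAIL-D AT `(p, d) = (5, 4)` REDUCED TO ITS TWO LOCATED RESIDUALS: the rotating B∞
# tail and the three-chart-letter tail (K2(p) lane, SLICE C / TAIL-D, brick (iii-β) «located residual theorem»;
# file-holder res-dim4-p-5 g4)

[OURS · counted 0 · cell `res-dim4-pi` · K2(p) lane, slice C (desk WORD #155 sequel) · seat p-5 g4.]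
Nothing here proves K2(p)/K2(5), `NoIsolatedTrap p p`, TAIL-D or resolution of singularities in dimension ≥ 4 / char. `p`.

TAIL-D of the holder's socket (`…ResConeSliceCSocket`, `d = 4` conjunct) reads: over `K`, no isolated above-floor
witnessed `Step0 5` chain with `x^{r₀} ∣ F₀` has constant shade `4` and `e_G ≡ 2` from some `k₀` on.  Sorting the
chart letters into RECURRENT ones (chart letter beyond every index) and the rest:
* `apply_eq_zero_of_never_chart` — a letter that is never the chart letter and free once is free for ever;
* **`false_of_eventually_constant_chart_four_five`** — ONE recurrent letter: the tail is eventually loss-free, dead by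
  res-dim4-p-5 g3's `…LossFreeTail.no_lossfree_tail`;
* **`tailD_four_five_of_residuals`** (and the normal-form variant `tailD_four_five_of_residuals'`) — TAIL-D at `(5,4)`
  FOLLOWS from the two located residuals:
  (R-D1) «ROTATING B∞»: chart letters in a pair `{a, a′}`, BOTH recurrent, and a passive letter `i` that is a boundary
  letter for ever (by `…BoundaryLetterFourFive.shape_of_permanent_boundary_letter` then `r_{k+1} = e_{j_k} + e_i`,
  `o ≡ 6`, every change of chart letter translating the previous one) ⇒ `False`;
  (R-D2) «THREE CHART LETTERS»: three distinct letters each recurrent ⇒ `False`.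
  Two recurrent letters with eventually free passive letters is brick (ii)'s `no_pair_tail_four_five`
  (`passive_eventually_const` sorts the passive letters).
[cite: CossartJannsenSaito2020, Thm. 3.14, Lemma 13.2, Lemma 13.4, Thm. 13.7] [cite: Hauser2010, §I (kangaroo phenomenon)]
bears_on: LADDER-RESOLUTION:D157-DOOR2 (res-dim4-pi · K2(p) = `RidgeBudget.NoAboveFloorTrap p p` · slice C, TAIL-D at (5,4)).
Supports stmt-ResolutionOfSingularities-16155 (helper).
-/

set_option linter.dupNamespace false -- mandated namespace of this single-conjunct summit

noncomputable section

namespace Summit.ResolutionOfSingularities.ResolutionOfSingularities.Theorems.PIDim4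

namespace ResCone

open MvPolynomial Finset
open Literature.AlgebraicGeometry.Resolution
open Literature.AlgebraicGeometry.Resolution.CentreBlowup
open Literature.AlgebraicGeometry.Resolution.Hauser2010
open Literature.AlgebraicGeometry.Resolution.HauserPerlega2019

variable {K : Type} [Field K] [CharP K 5] [DecidableEq K]

section TailDResidual

omit [CharP K 5] in
/-- A letter that is never the chart letter from `k` on and free at `k` is free for ever. [OURS · bookkeeping]
[cite: CossartJannsenSaito2020, Thm. 3.14] -/
theorem apply_eq_zero_of_never_chart {c : ℕ → State K} {j : ℕ → Fin 4} {b : ℕ → Fin 4 → K}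
    (hc : ∀ k, IsIsolated 5 (c k).F ∧ Step0 5 (c k) (c (k + 1))) (hw : FreeTail.IsWitnessedChain 5 c j b)
    (hr0 : ∀ e ∈ (c 0).F.support, (c 0).r ≤ e) (hfloor : ∀ k, ordZero (c k).F ≠ 5) {k : ℕ} {l : Fin 4}
    (hjl : ∀ m, k ≤ m → j m ≠ l) (h0 : (c k).r l = 0) : ∀ m, k ≤ m → (c m).r l = 0 := by
  haveI : Fact (Nat.Prime 5) := ⟨by norm_num⟩
  intro m hm
  induction m, hm using Nat.le_induction with
  | base => exact h0
  | succ m hm ih =>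
    by_cases hb : b m l = 0
    · rw [step_r_apply_of_untranslated 5 hc hw hr0 hfloor (hjl m hm).symm hb, ih]
    · exact apply_succ_eq_zero_of_translated hc hw hr0 hfloor (hjl m hm).symm hb

/-- **ONE RECURRENT CHART LETTER IS IMPOSSIBLE**: if the chart letter is eventually constant, every other letter
loses its component at most once and never regains one, so the tail is eventually loss-free — excluded by
`…LossFreeTail.no_lossfree_tail` (res-dim4-p-5 g3, every `d < p`, `e_G ≡ 2`). [OURS]
[cite: CossartJannsenSaito2020, Thm. 3.14, Lemma 13.2, Thm. 13.7] -/
theorem false_of_eventually_constant_chart_four_five {c : ℕ → State K} {j : ℕ → Fin 4} {b : ℕ → Fin 4 → K}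
    (hc : ∀ k, IsIsolated 5 (c k).F ∧ Step0 5 (c k) (c (k + 1))) (hw : FreeTail.IsWitnessedChain 5 c j b)
    (hr0 : ∀ e ∈ (c 0).F.support, (c 0).r ≤ e) (hfloor : ∀ k, ordZero (c k).F ≠ 5) {k₀ : ℕ}
    (hshade : ∀ k, k₀ ≤ k → (c k).shade = ((4 : ℕ) : ℕ∞))
    (he : ∀ k, k₀ ≤ k → Module.finrank K (resVertex (c k)) = 2) {a : Fin 4}
    (hconst : ∀ k, k₀ ≤ k → j k = a) : False := by
  haveI : Fact (Nat.Prime 5) := ⟨by norm_num⟩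
  -- each letter: a threshold after which a translation of it is a free translation
  have hthr : ∀ l : Fin 4, ∃ N, k₀ ≤ N ∧ ∀ k, N ≤ k → b k l ≠ 0 → (c k).r l = 0 := by
    intro l
    by_cases hla : l = a
    · refine ⟨k₀, le_rfl, fun k hk hb => absurd ?_ hb⟩
      rw [hla, ← hconst k hk]; exact (hw k).2.1
    · have hjl : ∀ m, k₀ ≤ m → j m ≠ l := fun m hm => by rw [hconst m hm]; exact fun h => hla h.symm
      by_cases hex : ∃ k, k₀ ≤ k ∧ b k l ≠ 0
      · obtain ⟨t, ht, hbt⟩ := hex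
        have h0 := apply_succ_eq_zero_of_translated hc hw hr0 hfloor (hjl t ht).symm hbt
        exact ⟨t + 1, by omega, fun k hk _ =>
          apply_eq_zero_of_never_chart hc hw hr0 hfloor (fun m hm => hjl m (by omega)) h0 k hk⟩
      · push Not at hex
        exact ⟨k₀, le_rfl, fun k hk hb => absurd (hex k hk) hb⟩
  choose N hN using hthr
  set M := Finset.univ.sup N with hM
  have hNM : ∀ l, N l ≤ M := fun l => Finset.le_sup (f := N) (Finset.mem_univ l)
  have hk₀M : k₀ ≤ M := (hN a).1.trans (hNM a)
  exact no_lossfree_tail 5 hc hw hr0 hfloor (k₀ := M) (d := 4) (by norm_num) (fun k hk => hshade k (by omega))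
    (fun k hk => he k (by omega)) fun k hk l hb => (hN l).2 k ((hNM l).trans hk) hb

/-- **TAIL-D AT `(5,4)` FROM ITS TWO LOCATED RESIDUALS.**  Over a field of characteristic `5`, suppose
(R-D1) no «rotating B∞ tail» — constant shade `4`, `e_G ≡ 2`, chart letters in a pair `{a, a′}` with BOTH letters
recurrent, and a third letter that is a boundary letter for ever — and (R-D2) no tail in which three distinct
letters are each the chart letter beyond every index.  Then TAIL-D holds at `(5,4)`: no isolated above-floor
witnessed `Step0 5` chain with `x^{r₀} ∣ F₀` has constant shade `4` and `e_G ≡ 2` from some index on.  (One recurrent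
letter: `false_of_eventually_constant_chart_four_five`; two recurrent letters: the passive letters are eventually
constant (`passive_eventually_const`), either all free — brick (ii)'s `no_pair_tail_four_five` — or one is a permanent
boundary letter — (R-D1); three: (R-D2).) [OURS]
[cite: CossartJannsenSaito2020, Thm. 3.14, Lemma 13.2, Lemma 13.4, Thm. 13.7] [cite: Hauser2010, §I (kangaroo phenomenon)] -/
theorem tailD_four_five_of_residuals
    (hRot : ∀ (c : ℕ → State K) (j : ℕ → Fin 4) (b : ℕ → Fin 4 → K),
      (∀ k, IsIsolated 5 (c k).F ∧ Step0 5 (c k) (c (k + 1))) → FreeTail.IsWitnessedChain 5 c j b →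
      (∀ e ∈ (c 0).F.support, (c 0).r ≤ e) → (∀ k, ordZero (c k).F ≠ (5 : ℕ)) →
      ∀ k₀ : ℕ, (∀ k, k₀ ≤ k → (c k).shade = ((4 : ℕ) : ℕ∞)) →
      (∀ k, k₀ ≤ k → Module.finrank K (resVertex (c k)) = 2) →
      ∀ a a' i : Fin 4, a ≠ a' → i ≠ a → i ≠ a' → (∀ k, k₀ ≤ k → (j k = a ∨ j k = a')) →
      (∀ N, ∃ k, N ≤ k ∧ j k = a) → (∀ N, ∃ k, N ≤ k ∧ j k = a') → (∀ k, k₀ ≤ k → 1 ≤ (c k).r i) → False)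
    (hThree : ∀ (c : ℕ → State K) (j : ℕ → Fin 4) (b : ℕ → Fin 4 → K),
      (∀ k, IsIsolated 5 (c k).F ∧ Step0 5 (c k) (c (k + 1))) → FreeTail.IsWitnessedChain 5 c j b →
      (∀ e ∈ (c 0).F.support, (c 0).r ≤ e) → (∀ k, ordZero (c k).F ≠ (5 : ℕ)) →
      ∀ k₀ : ℕ, (∀ k, k₀ ≤ k → (c k).shade = ((4 : ℕ) : ℕ∞)) →
      (∀ k, k₀ ≤ k → Module.finrank K (resVertex (c k)) = 2) →
      ∀ x y z : Fin 4, x ≠ y → y ≠ z → x ≠ z →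
      (∀ N, ∃ k, N ≤ k ∧ j k = x) → (∀ N, ∃ k, N ≤ k ∧ j k = y) → (∀ N, ∃ k, N ≤ k ∧ j k = z) → False)
    (c : ℕ → State K) (j : ℕ → Fin 4) (b : ℕ → Fin 4 → K)
    (hc : ∀ k, IsIsolated 5 (c k).F ∧ Step0 5 (c k) (c (k + 1))) (hw : FreeTail.IsWitnessedChain 5 c j b)
    (hr0 : ∀ e ∈ (c 0).F.support, (c 0).r ≤ e) (hfloor : ∀ k, ordZero (c k).F ≠ (5 : ℕ)) (k₀ : ℕ)
    (hshade : ∀ k, k₀ ≤ k → (c k).shade = ((4 : ℕ) : ℕ∞))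
    (he : ∀ k, k₀ ≤ k → Module.finrank K (resVertex (c k)) = 2) : False := by
  haveI : Fact (Nat.Prime 5) := ⟨by norm_num⟩
  -- recurrent letters and a common threshold for the non-recurrent ones
  have hthr : ∀ l : Fin 4, ∃ N, (∀ N', ∃ k, N' ≤ k ∧ j k = l) ∨ (∀ k, N ≤ k → j k ≠ l) := by
    intro l
    by_cases h : ∀ N', ∃ k, N' ≤ k ∧ j k = l
    · exact ⟨0, Or.inl h⟩
    · push Not at h
      obtain ⟨N, hN⟩ := h
      exact ⟨N, Or.inr hN⟩
  choose N hN using hthr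
  set M := max k₀ (Finset.univ.sup N) with hM
  have hNM : ∀ l, N l ≤ M := fun l => (Finset.le_sup (f := N) (Finset.mem_univ l)).trans (le_max_right _ _)
  have hk₀M : k₀ ≤ M := le_max_left _ _
  -- a chart letter beyond `M` is recurrent
  have hrec : ∀ k, M ≤ k → ∀ N', ∃ m, N' ≤ m ∧ j m = j k := by
    intro k hk
    rcases hN (j k) with h | h
    · exact h
    · exact absurd rfl (h k ((hNM (j k)).trans hk))
  -- a first recurrent letter
  set a := j M with ha
  have hreca : ∀ N', ∃ m, N' ≤ m ∧ j m = a := hrec M le_rfl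
  by_cases h2 : ∃ a', a' ≠ a ∧ ∀ N', ∃ m, N' ≤ m ∧ j m = a'
  · obtain ⟨a', ha'a, hreca'⟩ := h2
    by_cases h3 : ∃ z, z ≠ a ∧ z ≠ a' ∧ ∀ N', ∃ m, N' ≤ m ∧ j m = z
    · obtain ⟨z, hza, hza', hrecz⟩ := h3
      exact hThree c j b hc hw hr0 hfloor k₀ hshade he a a' z ha'a.symm hza'.symm hza.symm hreca hreca' hrecz
    · push Not at h3
      -- chart letters in `{a, a′}` beyond `M`
      have hletters : ∀ k, M ≤ k → (j k = a ∨ j k = a') := by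
        intro k hk
        by_contra hno
        push Not at hno
        obtain ⟨N', hN'⟩ := h3 (j k) hno.1 hno.2
        obtain ⟨m, hm, hjm⟩ := hrec k hk N'
        exact hN' m hm hjm
      obtain ⟨k₁, hk₁, hpc⟩ := passive_eventually_const 5 hc hw hr0 hfloor ha'a.symm hletters
      by_cases hp : ∀ i, i ≠ a → i ≠ a' → (c k₁).r i = 0
      · exact no_pair_tail_four_five hc hw hr0 hfloor (k₀ := k₁) (fun k hk => hshade k (by omega))
          (fun k hk => he k (by omega)) ha'a.symm (fun k hk => hletters k (by omega))
          fun k hk i hia hia' => by rw [(hpc k hk i hia hia').1]; exact hp i hia hia'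
      · push Not at hp
        obtain ⟨i, hia, hia', hri⟩ := hp
        exact hRot c j b hc hw hr0 hfloor k₁ (fun k hk => hshade k (by omega)) (fun k hk => he k (by omega)) a a' i
          ha'a.symm hia hia' (fun k hk => hletters k (by omega)) hreca hreca'
          fun k hk => by rw [(hpc k hk i hia hia').1]; omega
  · push Not at h2
    -- only `a` recurs: the chart letter is eventually constant
    have hthr' : ∀ l : Fin 4, ∃ N', ∀ k, N' ≤ k → j k ≠ l ∨ l = a := by
      intro l
      by_cases hla : l = a
      · exact ⟨0, fun k _ => Or.inr hla⟩
      · obtain ⟨N', hN'⟩ := h2 l hla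
        rcases hN l with h | h
        · obtain ⟨m, hm, hjm⟩ := h N'
          exact absurd hjm (hN' m hm)
        · exact ⟨N l, fun k hk => Or.inl (h k hk)⟩
    choose N' hN' using hthr'
    set M' := max M (Finset.univ.sup N') with hM'
    have hN'M : ∀ l, N' l ≤ M' := fun l => (Finset.le_sup (f := N') (Finset.mem_univ l)).trans (le_max_right _ _)
    refine false_of_eventually_constant_chart_four_five hc hw hr0 hfloor (k₀ := M') (a := a)
      (fun k hk => hshade k (by omega)) (fun k hk => he k (by omega)) fun k hk => ?_
    rcases hN' (j k) k ((hN'M (j k)).trans hk) with h | h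
    · exact absurd rfl h
    · exact h


/-- **TAIL-D AT `(5,4)` FROM THE RESIDUALS IN NORMAL FORM**: the same reduction with (R-D1) read through
`…BoundaryLetterFourFive.shape_of_permanent_boundary_letter` — the rotating B∞ tail is handed over WITH ITS SHAPE:
`b k i = 0` and `r_{k+1} = e_{j k} + e_i` for every `k ≥ k₀` (order `6`, weight `1` on the last chart letter and on the
fixed passive letter `i`). [OURS] [cite: CossartJannsenSaito2020, Thm. 3.14, Lemma 13.4, Thm. 13.7] -/
theorem tailD_four_five_of_residuals'
    (hRot : ∀ (c : ℕ → State K) (j : ℕ → Fin 4) (b : ℕ → Fin 4 → K),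
      (∀ k, IsIsolated 5 (c k).F ∧ Step0 5 (c k) (c (k + 1))) → FreeTail.IsWitnessedChain 5 c j b →
      (∀ e ∈ (c 0).F.support, (c 0).r ≤ e) → (∀ k, ordZero (c k).F ≠ (5 : ℕ)) →
      ∀ k₀ : ℕ, (∀ k, k₀ ≤ k → (c k).shade = ((4 : ℕ) : ℕ∞)) →
      (∀ k, k₀ ≤ k → Module.finrank K (resVertex (c k)) = 2) →
      ∀ a a' i : Fin 4, a ≠ a' → i ≠ a → i ≠ a' → (∀ k, k₀ ≤ k → (j k = a ∨ j k = a')) →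
      (∀ N, ∃ k, N ≤ k ∧ j k = a) → (∀ N, ∃ k, N ≤ k ∧ j k = a') →
      (∀ k, k₀ ≤ k → b k i = 0 ∧ (c (k + 1)).r = Finsupp.single (j k) 1 + Finsupp.single i 1) → False)
    (hThree : ∀ (c : ℕ → State K) (j : ℕ → Fin 4) (b : ℕ → Fin 4 → K),
      (∀ k, IsIsolated 5 (c k).F ∧ Step0 5 (c k) (c (k + 1))) → FreeTail.IsWitnessedChain 5 c j b →
      (∀ e ∈ (c 0).F.support, (c 0).r ≤ e) → (∀ k, ordZero (c k).F ≠ (5 : ℕ)) →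
      ∀ k₀ : ℕ, (∀ k, k₀ ≤ k → (c k).shade = ((4 : ℕ) : ℕ∞)) →
      (∀ k, k₀ ≤ k → Module.finrank K (resVertex (c k)) = 2) →
      ∀ x y z : Fin 4, x ≠ y → y ≠ z → x ≠ z →
      (∀ N, ∃ k, N ≤ k ∧ j k = x) → (∀ N, ∃ k, N ≤ k ∧ j k = y) → (∀ N, ∃ k, N ≤ k ∧ j k = z) → False)
    (c : ℕ → State K) (j : ℕ → Fin 4) (b : ℕ → Fin 4 → K)
    (hc : ∀ k, IsIsolated 5 (c k).F ∧ Step0 5 (c k) (c (k + 1))) (hw : FreeTail.IsWitnessedChain 5 c j b)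
    (hr0 : ∀ e ∈ (c 0).F.support, (c 0).r ≤ e) (hfloor : ∀ k, ordZero (c k).F ≠ (5 : ℕ)) (k₀ : ℕ)
    (hshade : ∀ k, k₀ ≤ k → (c k).shade = ((4 : ℕ) : ℕ∞))
    (he : ∀ k, k₀ ≤ k → Module.finrank K (resVertex (c k)) = 2) : False :=
  tailD_four_five_of_residuals
    (fun c j b hc hw hr0 hfloor k₀ hshade he a a' i haa hia hia' hletters hra hra' hbdry =>
      hRot c j b hc hw hr0 hfloor k₀ hshade he a a' i haa hia hia' hletters hra hra' fun k hk =>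
        shape_of_permanent_boundary_letter hc hw hr0 hfloor hshade
          (fun m hm h => by
            rcases hletters m hm with h' | h' <;> rw [h'] at h
            · exact hia h.symm
            · exact hia' h.symm)
          hbdry hk)
    hThree c j b hc hw hr0 hfloor k₀ hshade he

end TailDResidual

end ResCone

end Summit.ResolutionOfSingularities.ResolutionOfSingularities.Theorems.PIDim4

end
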